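import Mathlib.Algebra.Order.Chebyshev
import Literature.Analysis.Calculus.CoordinateJets
import Literature.Analysis.Calculus.MultilinearComponentBounds
import Literature.Analysis.PDE.EvansKrylovDifferentiated
import HarnessLib

/-!
# Evans–Krylov: calculus of the coordinate jets along a line (tools for GT (17.44)–(17.46))

Auxiliary calculus for the twice-differentiated equation of the Evans–Krylov theorem
(Gilbarg–Trudinger, §17.4, (17.44)–(17.46)) in the coordinate-jet language of
`Literature/Analysis/Calculus/CoordinateJets.lean`:

* `sq_apply_le_sum_sq_apply` — for an `m`-linear form `A` on a real inner product space with a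
  finite orthonormal basis `e` and arguments of norm `≤ 1`,
  `A(v)² ≤ Σ_{J : Fin m → ι} A(e_J)²` (components at unit vectors are bounded by the
  Hilbert–Schmidt size; induction on `m` with Cauchy–Schwarz in the first slot);
* `contDiffAt_cjetOf` — `cjet_m u` is `C^k` at `y` when `u` is `C^{m+k}` at `y`;
* `fderiv_cjetOf_apply`, `fderiv_fderiv_cjetOf_apply` — the components of the first and second
  derivatives of the jet map: `(D(cjet_m u)(y) v)_j (I) = D^{j+1}u(y)(v, e_I)` and
  `(D[z ↦ D(cjet_m u)(z) v](y) w)_j (I) = D^{j+2}u(y)(w, v, e_I)`;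
* `second_differential_cjetOf_eq_zero` — the twice-differentiated equation along the line
  `t ↦ y + t v`: if `F(z, θ, cjet₂ u(z)) = 0` on an open set `O ∋ y`, `u ∈ C⁴(O)`, `F ∈ C²`, then
  `D²F(x₀)[V, V] + DF(x₀)[(0, 0, W)] = 0` with `x₀ = (y, θ, cjet₂ u(y))`,
  `V = (v, 0, D(cjet₂ u)(y) v)`, `W = D[z ↦ D(cjet₂ u)(z) v](y) v` (GT (17.44) summed against
  `γ ⊗ γ`), via `second_deriv_comp_curve_eq_zero`;
* small re-indexing lemmas for tuples `(v, e_i, e_j)`, `(v, w, e_i, e_j)` and the symmetry of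
  `D³u`, `D⁴u` in the slots that are used.

Everything here is proved; no named facts.

## References

* D. Gilbarg, N. S. Trudinger, *Elliptic Partial Differential Equations of Second Order* (2001),
  §17.4, (17.44)–(17.46). [GilbargTrudinger2001]
-/

noncomputable section

open Filter Set Function
open scoped Topology InnerProductSpace RealInnerProductSpace

namespace Literature.Analysis.PDE.EvansKrylov

open Literature.Analysis.Calculus

variable {ι : Type*} [Fintype ι] {E : Type*} [NormedAddCommGroup E] [InnerProductSpace ℝ E]

/-! ### Components at unit vectors versus the Hilbert–Schmidt size -/

/-- **Components at unit vectors are bounded by the Hilbert–Schmidt size.** For an `m`-linear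
form `A` on a real inner product space with a finite orthonormal basis `e` and vectors `v_k` of
norm `≤ 1`, `A(v)² ≤ Σ_{J : Fin m → ι} A(e_{J 0}, …, e_{J (m-1)})²` (expand `v₀ = Σ ⟨e_i, v₀⟩ e_i`,
Cauchy–Schwarz, `Σ ⟨e_i, v₀⟩² = ‖v₀‖² ≤ 1`, and induction in the remaining slots). [folklore] -/
theorem sq_apply_le_sum_sq_apply (bE : OrthonormalBasis ι ℝ E) :
    ∀ (m : ℕ) (A : E [×m]→L[ℝ] ℝ) (v : Fin m → E), (∀ k, ‖v k‖ ≤ 1) →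
      (A v) ^ 2 ≤ ∑ J : Fin m → ι, (A (fun k => bE (J k))) ^ 2
  | 0, A, v, _ => by
      have hv : ∀ J : Fin 0 → ι, (fun k => bE (J k)) = v := fun J => funext fun k => k.elim0
      simp only [hv, Finset.sum_const, Finset.card_univ, Fintype.card_unique, one_smul, le_refl]
  | m + 1, A, v, hv => by
      -- expand the first argument in the basis
      have h1 : A v = ∑ i, ⟪bE i, v 0⟫ * A (Fin.cons (bE i) (Fin.tail v)) := by
        conv_lhs => rw [← Fin.cons_self_tail v, ← bE.sum_repr' (v 0)]
        rw [← ContinuousMultilinearMap.curryLeft_apply, map_sum, sum_apply]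
        refine Finset.sum_congr rfl fun i _ => ?_
        rw [map_smul, smul_apply, ContinuousMultilinearMap.curryLeft_apply, smul_eq_mul]
      -- induction hypothesis in the remaining slots, for each basis vector in the first slot
      have h2 : ∀ i, (A (Fin.cons (bE i) (Fin.tail v))) ^ 2 ≤
          ∑ J' : Fin m → ι, (A (Fin.cons (bE i) (fun k => bE (J' k)))) ^ 2 := by
        intro i
        have := sq_apply_le_sum_sq_apply bE m (A.curryLeft (bE i)) (Fin.tail v)
          (fun k => hv k.succ)
        simpa only [ContinuousMultilinearMap.curryLeft_apply] using this
      -- Cauchy–Schwarz in the first slot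
      have hCS := Finset.sum_mul_sq_le_sq_mul_sq Finset.univ (fun i => ⟪bE i, v 0⟫)
        (fun i => A (Fin.cons (bE i) (Fin.tail v)))
      rw [bE.sum_sq_inner_right] at hCS
      have hv0 : ‖v 0‖ ^ 2 ≤ 1 := by
        have := hv 0
        nlinarith [norm_nonneg (v 0)]
      have hS : 0 ≤ ∑ i, (A (Fin.cons (bE i) (Fin.tail v))) ^ 2 :=
        Finset.sum_nonneg fun i _ => sq_nonneg _
      calc (A v) ^ 2 = (∑ i, ⟪bE i, v 0⟫ * A (Fin.cons (bE i) (Fin.tail v))) ^ 2 := by rw [h1]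
        _ ≤ ‖v 0‖ ^ 2 * ∑ i, (A (Fin.cons (bE i) (Fin.tail v))) ^ 2 := hCS
        _ ≤ 1 * ∑ i, (A (Fin.cons (bE i) (Fin.tail v))) ^ 2 :=
          mul_le_mul_of_nonneg_right hv0 hS
        _ ≤ ∑ i, ∑ J' : Fin m → ι, (A (Fin.cons (bE i) (fun k => bE (J' k)))) ^ 2 := by
          rw [one_mul]
          exact Finset.sum_le_sum fun i _ => h2 i
        _ = ∑ J : Fin (m + 1) → ι, (A (fun k => bE (J k))) ^ 2 := by
          rw [← Fintype.sum_prod_type']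
          refine Fintype.sum_equiv (Fin.consEquiv fun _ => ι) _ _ fun p => ?_
          show _ = (A fun k => bE ((Fin.cons p.1 p.2 : Fin (m + 1) → ι) k)) ^ 2
          congr 2
          exact (Fin.comp_cons bE p.1 p.2).symm

/-- `|A(v)| ≤ (Σ_J A(e_J)²)^{1/2}` for arguments of norm `≤ 1` (square-root form of
`sq_apply_le_sum_sq_apply`). [folklore] -/
theorem abs_apply_le_sqrt_sum_sq_apply (bE : OrthonormalBasis ι ℝ E) {m : ℕ}
    (A : E [×m]→L[ℝ] ℝ) (v : Fin m → E) (hv : ∀ k, ‖v k‖ ≤ 1) :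
    |A v| ≤ Real.sqrt (∑ J : Fin m → ι, (A (fun k => bE (J k))) ^ 2) :=
  Real.abs_le_sqrt (sq_apply_le_sum_sq_apply bE m A v hv)

/-- `|A(v)| ≤ C` for an `m`-linear form with `‖A‖ ≤ C` and arguments of norm `≤ 1`. [folklore] -/
theorem abs_apply_le_of_opNorm_le {m : ℕ} (A : E [×m]→L[ℝ] ℝ) {C : ℝ} (hA : ‖A‖ ≤ C)
    (v : Fin m → E) (hv : ∀ k, ‖v k‖ ≤ 1) : |A v| ≤ C := by
  rw [← Real.norm_eq_abs]
  refine (A.le_mul_prod_of_opNorm_le_of_le hA hv).trans_eq ?_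
  simp

/-! ### Re-indexing of small tuples -/

/-- `(v, e_{I 0}, e_{I 1})` with `I = (i, j)` is the tuple `(v, e_i, e_j)`. [folklore] -/
theorem cons_basis_two (bE : OrthonormalBasis ι ℝ E) (v : E) (i j : ι) :
    (Fin.cons v (fun k => bE (![i, j] k)) : Fin 3 → E) = ![v, bE i, bE j] := by
  funext k
  refine Fin.cases rfl (fun l => ?_) k
  fin_cases l <;> rfl

/-- `(v, w, e_{I 0}, e_{I 1})` with `I = (i, j)` is the tuple `(v, w, e_i, e_j)`. [folklore] -/
theorem cons_cons_basis_two (bE : OrthonormalBasis ι ℝ E) (v w : E) (i j : ι) :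
    (Fin.cons v (Fin.cons w (fun k => bE (![i, j] k))) : Fin 4 → E) = ![v, w, bE i, bE j] := by
  funext k
  refine Fin.cases rfl (fun l => ?_) k
  refine Fin.cases rfl (fun l' => ?_) l
  fin_cases l' <;> rfl

/-- The arguments `(v, e_{I 0}, …)` have norm `≤ 1` when `‖v‖ ≤ 1`. [folklore] -/
theorem norm_cons_basis_le_one (bE : OrthonormalBasis ι ℝ E) {v : E} (hv : ‖v‖ ≤ 1) {n : ℕ}
    (I : Fin n → ι) : ∀ k, ‖(Fin.cons v (fun k => bE (I k)) : Fin (n + 1) → E) k‖ ≤ 1 := by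
  intro k
  refine Fin.cases ?_ (fun l => ?_) k
  · rwa [Fin.cons_zero]
  · rw [Fin.cons_succ]
    exact (bE.orthonormal.1 (I l)).le

/-- The arguments `(v, w, e_{I 0}, …)` have norm `≤ 1` when `‖v‖, ‖w‖ ≤ 1`. [folklore] -/
theorem norm_cons_cons_basis_le_one (bE : OrthonormalBasis ι ℝ E) {v w : E} (hv : ‖v‖ ≤ 1)
    (hw : ‖w‖ ≤ 1) {n : ℕ} (I : Fin n → ι) :
    ∀ k, ‖(Fin.cons v (Fin.cons w (fun k => bE (I k))) : Fin (n + 2) → E) k‖ ≤ 1 := by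
  intro k
  refine Fin.cases ?_ (fun l => ?_) k
  · rwa [Fin.cons_zero]
  · rw [Fin.cons_succ]
    exact norm_cons_basis_le_one bE hw I l

/-! ### Symmetries of `D³u` and `D⁴u` in the slots that occur -/

section Symm

variable {u : E → ℝ} {y : E}

/-- `D³u(y)(v, b, a) = D³u(y)(v, a, b)` for `u` of class `C⁴` at `y`. [folklore] -/
theorem iteratedFDeriv_three_swap (hu : ContDiffAt ℝ 4 u y) (v a b : E) :
    iteratedFDeriv ℝ 3 u y ![v, b, a] = iteratedFDeriv ℝ 3 u y ![v, a, b] := by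
  have e : (![v, b, a] : Fin 3 → E) = fun k => (![v, a, b] : Fin 3 → E) (Equiv.swap 1 2 k) := by
    funext k; fin_cases k <;> rfl
  rw [e, iteratedFDeriv_apply_perm_of_le hu (by exact_mod_cast (by norm_num : (3 : ℕ) ≤ 4))]

/-- `D⁴u(y)(v, w, b, a) = D⁴u(y)(v, w, a, b)` for `u` of class `C⁴` at `y`. [folklore] -/
theorem iteratedFDeriv_four_swap (hu : ContDiffAt ℝ 4 u y) (v w a b : E) :
    iteratedFDeriv ℝ 4 u y ![v, w, b, a] = iteratedFDeriv ℝ 4 u y ![v, w, a, b] := by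
  have e : (![v, w, b, a] : Fin 4 → E) =
      fun k => (![v, w, a, b] : Fin 4 → E) (Equiv.swap 2 3 k) := by
    funext k; fin_cases k <;> rfl
  rw [e, iteratedFDeriv_apply_perm_of_le hu (by exact_mod_cast (le_refl 4))]

/-- `D⁴u(y)(v, w, a, b) = D⁴u(y)(a, b, v, w)` for `u` of class `C⁴` at `y`. [folklore] -/
theorem iteratedFDeriv_four_rotate (hu : ContDiffAt ℝ 4 u y) (v w a b : E) :
    iteratedFDeriv ℝ 4 u y ![v, w, a, b] = iteratedFDeriv ℝ 4 u y ![a, b, v, w] := by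
  have e : (![v, w, a, b] : Fin 4 → E) =
      fun k => (![a, b, v, w] : Fin 4 → E)
        ((Equiv.swap (0 : Fin 4) 2 * Equiv.swap (1 : Fin 4) 3 : Equiv.Perm (Fin 4)) k) := by
    funext k; fin_cases k <;> rfl
  rw [e, iteratedFDeriv_apply_perm_of_le hu (by exact_mod_cast (le_refl 4))]

end Symm

/-! ### Smoothness and derivatives of the coordinate jet map, componentwise -/

/-- Finite smoothness of the jet map at a point: `cjet_m u` is `C^k` at `y` when `u` is
`C^{m+k}` at `y` (each component `z ↦ Dʲu(z)(e_I)`, `j ≤ m`, is). [folklore] -/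
theorem contDiffAt_cjetOf (bE : OrthonormalBasis ι ℝ E) {m k : ℕ} {u : E → ℝ} {y : E}
    (hu : ContDiffAt ℝ (m + k : ℕ) u y) : ContDiffAt ℝ k (cjetOf bE m u) y := by
  refine contDiffAt_pi.2 fun j => contDiffAt_pi.2 fun I => ?_
  have hle : (k : WithTop ℕ∞) + ((j : ℕ) : WithTop ℕ∞) ≤ ((m + k : ℕ) : WithTop ℕ∞) := by
    have := j.is_le
    exact_mod_cast (by omega : k + (j : ℕ) ≤ m + k)
  have h1 : ContDiffAt ℝ k (iteratedFDeriv ℝ (j : ℕ) u) y := hu.iteratedFDeriv_right hle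
  exact (ContinuousMultilinearMap.apply ℝ (fun _ : Fin (j : ℕ) => E) ℝ
    (fun k => bE (I k))).contDiff.contDiffAt.comp y h1

/-- **Components of the derivative of the jet map**: for `u` of class `C^{m+1}` at `y`,
`(D(cjet_m u)(y) v)_j (I) = D^{j+1}u(y)(v, e_{I 0}, …, e_{I (j-1)})`. [folklore] -/
theorem fderiv_cjetOf_apply (bE : OrthonormalBasis ι ℝ E) {m : ℕ} {u : E → ℝ} {y : E}
    (hu : ContDiffAt ℝ (m + 1 : ℕ) u y) (v : E) (j : Fin (m + 1)) (I : Fin (j : ℕ) → ι) :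
    fderiv ℝ (cjetOf bE m u) y v j I =
      iteratedFDeriv ℝ ((j : ℕ) + 1) u y (Fin.cons v fun k => bE (I k)) := by
  have hd : DifferentiableAt ℝ (cjetOf bE m u) y := (hasFDerivAt_cjetOf_apply bE hu).1
  have h1 : HasFDerivAt (fun z => cjetOf bE m u z j I)
      ((ContinuousLinearMap.proj I).comp
        ((ContinuousLinearMap.proj j).comp (fderiv ℝ (cjetOf bE m u) y))) y :=
    hasFDerivAt_pi'.1 (hasFDerivAt_pi'.1 hd.hasFDerivAt j) I
  have hj : ContDiffAt ℝ ((j : ℕ) + 1 : ℕ) u y :=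
    hu.of_le (by exact_mod_cast Nat.succ_le_of_lt j.isLt)
  have h2 := fderiv_iteratedFDeriv_apply_const hj (fun k => bE (I k)) v
  rw [← h2, show (fun z => iteratedFDeriv ℝ (j : ℕ) u z fun k => bE (I k)) =
    fun z => cjetOf bE m u z j I from rfl, h1.fderiv]
  rfl

/-- **Components of the second derivative of the jet map**: for `u` of class `C^{m+2}` at `y`,
`(D[z ↦ D(cjet_m u)(z) v](y) w)_j (I) = D^{j+2}u(y)(w, v, e_{I 0}, …, e_{I (j-1)})`. [folklore] -/
theorem fderiv_fderiv_cjetOf_apply (bE : OrthonormalBasis ι ℝ E) {m : ℕ} {u : E → ℝ} {y : E}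
    (hu : ContDiffAt ℝ (m + 2 : ℕ) u y) (v w : E) (j : Fin (m + 1)) (I : Fin (j : ℕ) → ι) :
    fderiv ℝ (fun z => fderiv ℝ (cjetOf bE m u) z v) y w j I =
      iteratedFDeriv ℝ ((j : ℕ) + 1 + 1) u y (Fin.cons w (Fin.cons v fun k => bE (I k))) := by
  set g : E → CJet ι m := fun z => fderiv ℝ (cjetOf bE m u) z v with hg
  have hJ2 : ContDiffAt ℝ 2 (cjetOf bE m u) y := contDiffAt_cjetOf bE (m := m) (k := 2) hu
  have hdf : DifferentiableAt ℝ (fderiv ℝ (cjetOf bE m u)) y :=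
    (hJ2.fderiv_right (m := 1) (by norm_num)).differentiableAt one_ne_zero
  have hgd : DifferentiableAt ℝ g y := hdf.clm_apply (differentiableAt_const v)
  have h1 : HasFDerivAt (fun z => g z j I)
      ((ContinuousLinearMap.proj I).comp
        ((ContinuousLinearMap.proj j).comp (fderiv ℝ g y))) y :=
    hasFDerivAt_pi'.1 (hasFDerivAt_pi'.1 hgd.hasFDerivAt j) I
  -- near `y`, the component `(j, I)` of `g` is `z ↦ D^{j+1}u(z)(v, e_I)`
  have hnear : ∀ᶠ z in 𝓝 y, ContDiffAt ℝ (m + 1 : ℕ) u z :=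
    (hu.of_le (by exact_mod_cast (by omega : m + 1 ≤ m + 2))).eventually (by simp)
  have hEq : (fun z => g z j I) =ᶠ[𝓝 y]
      fun z => iteratedFDeriv ℝ ((j : ℕ) + 1) u z (Fin.cons v fun k => bE (I k)) := by
    filter_upwards [hnear] with z hz
    exact fderiv_cjetOf_apply bE hz v j I
  have hj : ContDiffAt ℝ ((j : ℕ) + 1 + 1 : ℕ) u y :=
    hu.of_le (by exact_mod_cast Nat.succ_le_succ (Nat.succ_le_of_lt j.isLt))
  have h2 := fderiv_iteratedFDeriv_apply_const hj (Fin.cons v fun k => bE (I k)) w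
  rw [← h2, ← hEq.fderiv_eq, h1.fderiv]
  rfl

/-! ### The twice-differentiated equation along a line -/

section Curve

variable {P : Type*} [NormedAddCommGroup P] [NormedSpace ℝ P]

/-- **The twice-differentiated equation along a line (GT (17.44) contracted with `γ ⊗ γ`).**
If `F(z, θ, cjet₂ u(z)) = 0` on an open set `O ∋ y`, `u ∈ C⁴(O)` and `F ∈ C²` on
`{x | x.1 ∈ O}`, then with `x₀ = (y, θ, cjet₂ u(y))`, `V = (v, 0, D(cjet₂ u)(y) v)` and
`W = D[z ↦ D(cjet₂ u)(z) v](y) v`,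
`D²F(x₀)[V, V] + DF(x₀)[(0, 0, W)] = 0`
(the second derivative at `t = 0` of `t ↦ F(y + tv, θ, cjet₂ u(y + tv)) ≡ 0`).
[cite: GilbargTrudinger2001, §17.4 (17.44)] -/
theorem second_differential_cjetOf_eq_zero (bE : OrthonormalBasis ι ℝ E) {O : Set E}
    (hO : IsOpen O) {u : E → ℝ} (hu : ContDiffOn ℝ 4 u O) {F : E × P × CJet ι 2 → ℝ} {θ : P}
    (hF : ContDiffOn ℝ 2 F {x | x.1 ∈ O})
    (hF0 : ∀ z ∈ O, F (z, θ, cjetOf bE 2 u z) = 0) {y : E} (hy : y ∈ O) (v : E) :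
    fderiv ℝ (fderiv ℝ F) (y, θ, cjetOf bE 2 u y)
        (v, (0 : P), fderiv ℝ (cjetOf bE 2 u) y v) (v, (0 : P), fderiv ℝ (cjetOf bE 2 u) y v) +
      fderiv ℝ F (y, θ, cjetOf bE 2 u y)
        ((0 : E), (0 : P), fderiv ℝ (fun z => fderiv ℝ (cjetOf bE 2 u) z v) y v) = 0 := by
  -- the curve and its first two derivatives
  set ℓ : ℝ → E := fun t => y + t • v with hℓ
  set c : ℝ → E × P × CJet ι 2 := fun t => (ℓ t, θ, cjetOf bE 2 u (ℓ t)) with hc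
  set c' : ℝ → E × P × CJet ι 2 := fun t => (v, (0 : P), fderiv ℝ (cjetOf bE 2 u) (ℓ t) v)
    with hc'
  set c'' : ℝ → E × P × CJet ι 2 :=
    fun _ => ((0 : E), (0 : P), fderiv ℝ (fun z => fderiv ℝ (cjetOf bE 2 u) z v) y v) with hc''
  have hℓ0 : ℓ 0 = y := by simp [hℓ]
  have hℓd : ∀ t, HasDerivAt ℓ v t := fun t => by
    have h := ((hasDerivAt_id t).smul_const v).const_add y
    simpa [hℓ] using h
  have hℓc : Continuous ℓ := continuous_const.add (continuous_id.smul continuous_const)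
  -- points of the line near `t = 0` lie in `O`
  have hnear : ∀ᶠ t in 𝓝 (0 : ℝ), ℓ t ∈ O :=
    hℓc.continuousAt.eventually_mem (by rw [hℓ0]; exact hO.mem_nhds hy)
  -- first derivative of the curve near `0`
  have hcd : ∀ᶠ t in 𝓝 (0 : ℝ), HasDerivAt c (c' t) t := by
    filter_upwards [hnear] with t ht
    have h3 : ContDiffAt ℝ (2 + 1 : ℕ) u (ℓ t) :=
      (hu.contDiffAt (hO.mem_nhds ht)).of_le (by norm_num)
    have hJ : HasDerivAt (fun s => cjetOf bE 2 u (ℓ s)) (fderiv ℝ (cjetOf bE 2 u) (ℓ t) v) t :=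
      (hasFDerivAt_cjetOf_apply bE h3).1.hasFDerivAt.comp_hasDerivAt t (hℓd t)
    exact (hℓd t).prodMk ((hasDerivAt_const t θ).prodMk hJ)
  -- second derivative of the curve at `0`
  have hc'd : HasDerivAt c' (c'' 0) 0 := by
    have hy4 : ContDiffAt ℝ (2 + 2 : ℕ) u y := (hu.contDiffAt (hO.mem_nhds hy)).of_le (by norm_num)
    have hJ2 : ContDiffAt ℝ 2 (cjetOf bE 2 u) y := contDiffAt_cjetOf bE hy4
    have hdf : DifferentiableAt ℝ (fderiv ℝ (cjetOf bE 2 u)) y :=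
      (hJ2.fderiv_right (m := 1) (by norm_num)).differentiableAt one_ne_zero
    have hgd : DifferentiableAt ℝ (fun z => fderiv ℝ (cjetOf bE 2 u) z v) y :=
      hdf.clm_apply (differentiableAt_const v)
    have hg : HasDerivAt (fun t => fderiv ℝ (cjetOf bE 2 u) (ℓ t) v)
        (fderiv ℝ (fun z => fderiv ℝ (cjetOf bE 2 u) z v) y v) 0 :=
      hgd.hasFDerivAt.comp_hasDerivAt_of_eq 0 (hℓd 0) hℓ0.symm
    exact (hasDerivAt_const (0 : ℝ) v).prodMk ((hasDerivAt_const (0 : ℝ) (0 : P)).prodMk hg)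
  -- `F` is `C²` at `c 0`, differentiable along the curve, and `F ∘ c ≡ 0` near `0`
  have hOpen : IsOpen {x : E × P × CJet ι 2 | x.1 ∈ O} := hO.preimage continuous_fst
  have hc0 : c 0 = (y, θ, cjetOf bE 2 u y) := by simp [hc, hℓ0]
  have hFc : ContDiffAt ℝ 2 F (c 0) := hF.contDiffAt (hOpen.mem_nhds (by rw [hc0]; exact hy))
  have hFd : ∀ᶠ t in 𝓝 (0 : ℝ), DifferentiableAt ℝ F (c t) := by
    filter_upwards [hnear] with t ht
    exact (hF.contDiffAt (hOpen.mem_nhds ht)).differentiableAt (by norm_num)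
  have heq : ∀ᶠ t in 𝓝 (0 : ℝ), F (c t) = 0 := by
    filter_upwards [hnear] with t ht
    exact hF0 (ℓ t) ht
  have h := second_deriv_comp_curve_eq_zero (c := c) (c' := c') (c'' := c'') hFc hFd hcd hc'd heq
  have hc'0 : c' 0 = (v, (0 : P), fderiv ℝ (cjetOf bE 2 u) y v) := by simp [hc', hℓ0]
  rw [hc0, hc'0] at h
  exact h

end Curve

end Literature.Analysis.PDE.EvansKrylov

end
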